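import Summits.HubbardSuperconductivity.HubbardSuperconductivity.Cruxes.SsbToEvenTorusLro.Disproof
import Summits.HubbardSuperconductivity.HubbardSuperconductivity.Cruxes.SsbToEvenTorusLro.StrategyCensus
import HarnessLib

/-!
# Strategy census r1 (second opinion) — Lean companion for crux `SsbToEvenTorusLro` (stmt-HubbardSuperconductivity-1315)

Seat: planner-cstrat-stmt-HubbardSuperconductivity-1315-r1-0 (crux-strategist, REDIRECT r1, 2026-08-17).
Companion of `Cruxes/SsbToEvenTorusLro/STRATEGY-CENSUS-r1.md`. Everything here is a checked theorem (no `sorry`).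

* §1 General finite-dimensional lemmas (real diagonal matrices: Rayleigh quotient, ground energy, ground space;
  `ω_A(Y) = 0` whenever `A Y = c Y` with `c ≠ E₀(A)`).
* §2 **U(1)-COVARIANT ANDERSON-TOWER CERTIFICATE** (`u1Covariant_ssb_without_lro`). The p1 census certified that
  the crux SHAPE "Koma–Tasaki order ⇒ order of the source-free finite-volume ground states" is model-free false with
  a two-level family whose order operator is Hermitian and charge-NEUTRAL (`StrategyCensus.abstract_ssb_without_lro`).
  The natural objection — "a pair field carries charge `-2`, its symmetric expectation vanishes, and the physics of the
  transfer is the tower of number sectors; number conservation + sector structure + density matching + uniqueness of the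
  sector ground state might rescue the abstract implication" — is answered here in the negative by a three-level family
  `(H_L, O_L, Q_N)` on `ℂ³` (dark state `B`, two tower states): `H_L` Hermitian with a conserved charge `Q_N`
  (`[Q_N, H_L] = 0`), `O_L` a genuine charge-`(-2)` operator (`[Q_N, O_L] = -2 O_L`, so `ω(O_L) = 0` in every
  charge eigenstate), Koma–Tasaki order parameter EXACTLY `1/2` computed with the literal shape of
  `dWaveOrderParameter` (`StrategyCensus.ktOrderParameter`: source `-h(O+Oᴴ)`, tracial ground state, `L → ∞` first,
  then `h ↓ 0`), tracial "density" `ω_{H_L}(Q_N) = N` for EVERY `N` (so density matching to any `1-δ` is available),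
  and yet at every volume the source-free ground state is the UNIQUE ray `B`, which lies in the charge-`N` sector and is
  ANNIHILATED by `O_L` (zero order, zero pair fluctuation). Reading: no proof of the crux can factor through
  {Koma–Tasaki order, exact `U(1)` covariance of a charge-2 order operator, sector structure, density matching,
  uniqueness of the sector ground state, finite-dimensional spectral theory}; it must use a MODEL-SPECIFIC thermodynamic
  exclusion (no iso-`μ` coexistence of the ordered phase with an order-dark phase) at every `(U, μ)` the crux quantifies
  over — the (O2) wall of the p1 census, now with the tower/number structure included.
* §3 The only honest cut of the crux is by PARAMETER REGION, and it is not a decomposition of content: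
  `SsbToEvenTorusLro ↔ BoxTransfer ∧ OffBoxTransfer` (glue `crux_of_box_of_offBox` proved), the route's deciding theorem
  needs `BoxTransfer` only (`Disproof.closes_box`, re-exported as `closes_box'`), and the off-box conjunct is a
  summit-independent GLOBAL phase-diagram assertion — e.g. it forbids, at EVERY coupling `U > 3`, density-matched
  Koma–Tasaki `d`-wave order wherever the summit's sector is eventually Nagaoka-saturated
  (`offBox_imp_noOrder_of_eventually_saturated`, from the disprover's §8e). This is the typed evidence for the census'
  Decomposition heading (piece probes recorded in the census) and for the tribunal's re-target.
-/

noncomputable section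

set_option linter.dupNamespace false
set_option linter.unusedSectionVars false

namespace Summit.HubbardSuperconductivity.HubbardSuperconductivity.Cruxes.SsbToEvenTorusLro.StrategyCensusR1

open Matrix Filter Set
open scoped ComplexOrder
open _root_.Topology
open Literature.MathematicalPhysics.QuantumLattice (HasDWaveOrder)
open Literature.Barriers.HubbardSuperconductivity (HasDWavePairFieldLROAt)
open Summit.HubbardSuperconductivity.HubbardSuperconductivity.Cruxes.SsbToEvenTorusLro.StrategyCensus
  (ktOrderParameter groundEnergy_eq_of_bound)
open Summit.HubbardSuperconductivity.HubbardSuperconductivity.Cruxes.SsbToEvenTorusLro.Disproof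
  (BoxTransfer Body DensityMatched SaturatedAt crux_iff crux_imp_boxTransfer closes_box
    not_matrix_of_eventually_saturated)
open Summit.HubbardSuperconductivity.HubbardSuperconductivity.Theses.AposterioriCapRg
  (SsbToEvenTorusLro FixedPointDWaveOrder)

/-! ## §1 General finite-dimensional lemmas -/

section General

variable {n : Type*} [Fintype n] [DecidableEq n]

/-- `⟨ψ, ψ⟩ = Σ |ψ i|²` as a real number cast to `ℂ`. [folklore] -/
theorem star_dotProduct_self (ψ : n → ℂ) :
    star ψ ⬝ᵥ ψ = ((∑ i, Complex.normSq (ψ i) : ℝ) : ℂ) := by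
  rw [dotProduct, Complex.ofReal_sum]
  refine Finset.sum_congr rfl fun i _ => ?_
  rw [Pi.star_apply, Complex.star_def, Complex.normSq_eq_conj_mul_self]

/-- Rayleigh quotient of a real diagonal matrix: `⟨ψ, diag(d) ψ⟩ = Σ dᵢ |ψ i|²`. [folklore] -/
theorem rayleigh_diagonal (d : n → ℝ) (ψ : n → ℂ) :
    star ψ ⬝ᵥ (diagonal fun i => (d i : ℂ)) *ᵥ ψ = ((∑ i, d i * Complex.normSq (ψ i) : ℝ) : ℂ) := by
  rw [dotProduct, Complex.ofReal_sum]
  refine Finset.sum_congr rfl fun i _ => ?_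
  rw [mulVec_diagonal, Pi.star_apply, Complex.star_def, Complex.ofReal_mul,
    Complex.normSq_eq_conj_mul_self]
  ring

/-- A real diagonal matrix is Hermitian. [folklore] -/
theorem diagonal_real_isHermitian (d : n → ℝ) : (diagonal fun i => (d i : ℂ)).IsHermitian := by
  change (diagonal fun i => (d i : ℂ))ᴴ = diagonal fun i => (d i : ℂ)
  rw [diagonal_conjTranspose]
  congr 1
  funext i
  exact Complex.conj_ofReal _

/-- Unit vectors have `Σ |ψ i|² = 1`. [folklore] -/
theorem sum_normSq_eq_one_of_unit {ψ : n → ℂ} (hψ : star ψ ⬝ᵥ ψ = 1) :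
    ∑ i, Complex.normSq (ψ i) = 1 := by
  have h := star_dotProduct_self ψ
  rw [hψ] at h
  exact_mod_cast h.symm

/-- **Ground energy of a real diagonal matrix** = any minimal diagonal entry (variational principle both ways).
[folklore] -/
theorem groundEnergy_diagonal [Nonempty n] (d : n → ℝ) (k : n) (hk : ∀ i, d k ≤ d i) :
    (diagonal fun i => (d i : ℂ)).groundEnergy = d k := by
  refine groundEnergy_eq_of_bound (diagonal_real_isHermitian d) (d k) ?_ (Pi.single k 1) ?_ ?_
  · intro ψ hψ
    have h1 := sum_normSq_eq_one_of_unit hψ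
    rw [rayleigh_diagonal, Complex.ofReal_re]
    calc d k = ∑ i, d k * Complex.normSq (ψ i) := by rw [← Finset.mul_sum, h1, mul_one]
      _ ≤ ∑ i, d i * Complex.normSq (ψ i) :=
          Finset.sum_le_sum fun i _ => mul_le_mul_of_nonneg_right (hk i) (Complex.normSq_nonneg _)
  · rw [star_dotProduct_self]
    have : ∀ i, Complex.normSq ((Pi.single k (1 : ℂ) : n → ℂ) i) = if i = k then 1 else 0 := by
      intro i
      by_cases hi : i = k
      · subst hi; simp
      · simp [hi]
    simp_rw [this]
    simp
  · rw [rayleigh_diagonal, Complex.ofReal_re]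
    have : ∀ i, d i * Complex.normSq ((Pi.single k (1 : ℂ) : n → ℂ) i) = if i = k then d k else 0 := by
      intro i
      by_cases hi : i = k
      · subst hi; simp
      · simp [hi]
    simp_rw [this]
    simp

/-- **Ground space of a real diagonal matrix with a STRICT unique minimum at `k`** = the vectors supported at `k`.
[folklore] -/
theorem mem_groundSpace_diagonal_iff [Nonempty n] (d : n → ℝ) (k : n) (hk : ∀ i, i ≠ k → d k < d i)
    (v : n → ℂ) : v ∈ (diagonal fun i => (d i : ℂ)).groundSpace ↔ ∀ i, i ≠ k → v i = 0 := by
  have hk' : ∀ i, d k ≤ d i := by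
    intro i
    by_cases h : i = k
    · rw [h]
    · exact (hk i h).le
  rw [mem_groundSpace_iff, groundEnergy_diagonal d k hk']
  constructor
  · intro h i hi
    have hi' := congrFun h i
    rw [mulVec_diagonal, Pi.smul_apply, smul_eq_mul] at hi'
    have hne : (d i : ℂ) ≠ (d k : ℂ) := by exact_mod_cast (hk i hi).ne'
    have hz : ((d i : ℂ) - d k) * v i = 0 := by rw [sub_mul, hi', sub_self]
    rcases mul_eq_zero.1 hz with h0 | h0
    · exact absurd (sub_eq_zero.1 h0) hne
    · exact h0
  · intro h
    funext i
    rw [mulVec_diagonal, Pi.smul_apply, smul_eq_mul]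
    by_cases hi : i = k
    · subst hi; rfl
    · rw [h i hi, mul_zero, mul_zero]

/-- **Selection rule for the tracial ground state**: if `A Y = c Y` with `c ≠ E₀(A)` then `ω_A(Y) = 0`
(`ω(AY) = E₀ ω(Y)` against `ω(AY) = c ω(Y)`). [folklore] -/
theorem groundStateFunctional_eq_zero_of_mul_eq_smul {A Y : Matrix n n ℂ} (hA : A.IsHermitian) {c : ℂ}
    (hY : A * Y = c • Y) (hc : c ≠ (A.groundEnergy : ℂ)) : A.groundStateFunctional Y = 0 := by
  have h := groundStateFunctional_hamiltonian_mul hA Y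
  rw [hY, map_smul, smul_eq_mul] at h
  have hz : (c - A.groundEnergy) * A.groundStateFunctional Y = 0 := by rw [sub_mul, h, sub_self]
  rcases mul_eq_zero.1 hz with h0 | h0
  · exact absurd (sub_eq_zero.1 h0) hc
  · exact h0

end General

/-! ## §2 The U(1)-covariant Anderson-tower certificate -/

section Tower

/-- Source-free spectrum in the basis `(B, +, −)`: the dark state `B` at energy `0`, the two tower states at `1`.
(`±` are the symmetric/antisymmetric combinations of the tower's charge eigenstates `a₀` (charge `N-2`) and `a₁`
(charge `N`); in this basis the source term is diagonal.) -/
def towerDiag : Fin 3 → ℝ := ![0, 1, 1]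

/-- The source-free Hamiltonians `H_L = diag(0, 1, 1)` (volume-independent). -/
def towerH : ℕ → Matrix (Fin 3) (Fin 3) ℂ := fun _ => diagonal fun i => (towerDiag i : ℂ)

/-- `M = |a₀⟩⟨a₁|` written in the `(B, +, −)` basis (`a₀ = (e₊ + e₋)/√2`, `a₁ = (e₊ − e₋)/√2`). -/
def towerM : Matrix (Fin 3) (Fin 3) ℂ := !![0, 0, 0; 0, 1, -1; 0, 1, -1]

/-- The pair operators `O_L = (L²/2)·|a₀⟩⟨a₁|` (extensive matrix element, like `Δ_d` between tower states). -/
def towerO : ℕ → Matrix (Fin 3) (Fin 3) ℂ := fun L => (((L : ℝ) ^ 2 / 2 : ℝ) : ℂ) • towerM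

/-- `J = 2|a₀⟩⟨a₀|` in the `(B, +, −)` basis. -/
def towerJ : Matrix (Fin 3) (Fin 3) ℂ := !![0, 0, 0; 0, 1, 1; 0, 1, 1]

/-- The charge normalised to the sector label `N`: `Q_N = N` on `B` and `a₁`, `N − 2` on `a₀`; i.e. `N·1 − J`. -/
def towerQ (N : ℕ) : Matrix (Fin 3) (Fin 3) ℂ := (N : ℂ) • (1 : Matrix (Fin 3) (Fin 3) ℂ) - towerJ

/-- The sourced spectrum `diag(0, 1 − hL², 1 + hL²)`. -/
def sourcedDiag (h : ℝ) (L : ℕ) : Fin 3 → ℝ := ![0, 1 - h * (L : ℝ) ^ 2, 1 + h * (L : ℝ) ^ 2]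

theorem towerH_isHermitian (L : ℕ) : (towerH L).IsHermitian :=
  diagonal_real_isHermitian _

theorem towerJ_isHermitian : towerJ.IsHermitian := by
  change towerJᴴ = towerJ
  ext i j
  fin_cases i <;> fin_cases j <;> simp [towerJ, conjTranspose_apply]

theorem towerQ_isHermitian (N : ℕ) : (towerQ N).IsHermitian := by
  unfold towerQ
  refine IsHermitian.sub ?_ towerJ_isHermitian
  change ((N : ℂ) • (1 : Matrix (Fin 3) (Fin 3) ℂ))ᴴ = (N : ℂ) • (1 : Matrix (Fin 3) (Fin 3) ℂ)
  rw [conjTranspose_smul, conjTranspose_one, Complex.star_def, Complex.conj_natCast]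

/-- `[Q_N, H_L] = 0`: the charge is conserved. [folklore] -/
theorem towerQ_mul_towerH (N L : ℕ) : towerQ N * towerH L = towerH L * towerQ N := by
  ext i j
  fin_cases i <;> fin_cases j <;>
    simp [towerQ, towerJ, towerH, towerDiag, Matrix.mul_apply, diagonal_apply]

/-- `[Q_N, O_L] = −2 O_L`: the order operator carries charge `−2` (a pair ANNIHILATOR, not a neutral observable).
[folklore] -/
theorem towerQ_commutator_towerO (N L : ℕ) :
    towerQ N * towerO L - towerO L * towerQ N = (-2 : ℂ) • towerO L := by
  ext i j
  fin_cases i <;> fin_cases j <;>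
    simp [towerQ, towerJ, towerO, towerM, Matrix.sub_mul, Matrix.mul_sub, Matrix.smul_apply] <;> ring

/-- `O_L² = 0` (a two-level tower: the pair operator is nilpotent, as a lowering operator should be). [folklore] -/
theorem towerO_mul_self (L : ℕ) : towerO L * towerO L = 0 := by
  ext i j
  fin_cases i <;> fin_cases j <;>
    simp [towerO, towerM, Matrix.mul_apply, Fin.sum_univ_three]

/-- The sourced Hamiltonian is diagonal in the `(B, +, −)` basis: `H_L − h(O_L + O_Lᴴ) = diag(0, 1 − hL², 1 + hL²)`.
[folklore] -/
theorem sourced_eq (h : ℝ) (L : ℕ) :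
    towerH L - (h : ℂ) • (towerO L + (towerO L)ᴴ) = diagonal fun i => (sourcedDiag h L i : ℂ) := by
  ext i j
  fin_cases i <;> fin_cases j <;>
    simp [towerH, towerDiag, towerO, towerM, sourcedDiag, Matrix.sub_apply,
      Matrix.smul_apply, Matrix.add_apply, conjTranspose_apply] <;> ring

/-- In the field-dominated regime `hL² ≥ 1` the sourced ground energy is `1 − hL²` (the `+` tower state). [folklore] -/
theorem groundEnergy_sourced {h : ℝ} {L : ℕ} (hh : 0 ≤ h) (hbig : 1 ≤ h * (L : ℝ) ^ 2) :
    (towerH L - (h : ℂ) • (towerO L + (towerO L)ᴴ)).groundEnergy = 1 - h * (L : ℝ) ^ 2 := by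
  rw [sourced_eq, groundEnergy_diagonal (sourcedDiag h L) 1 ?_]
  · simp [sourcedDiag]
  · intro i
    have hnn : 0 ≤ h * (L : ℝ) ^ 2 := mul_nonneg hh (sq_nonneg _)
    fin_cases i <;> simp [sourcedDiag] <;> linarith

/-- The source-free ground energy is `0`. [folklore] -/
theorem groundEnergy_towerH (L : ℕ) : (towerH L).groundEnergy = 0 := by
  show (diagonal fun i => ((towerDiag i : ℝ) : ℂ)).groundEnergy = 0
  rw [groundEnergy_diagonal towerDiag 0 ?_]
  · simp [towerDiag]
  · intro i
    fin_cases i <;> simp [towerDiag]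

/-- In the sourced tracial ground state (regime `hL² > 1`) the projection onto the dark state has weight `0`
(selection rule: `A Π_B = 0·Π_B` while `E₀(A) = 1 − hL² ≠ 0`). [folklore] -/
theorem sourced_functional_darkProj {h : ℝ} {L : ℕ} (hh : 0 ≤ h) (hbig : 1 < h * (L : ℝ) ^ 2) :
    (towerH L - (h : ℂ) • (towerO L + (towerO L)ᴴ)).groundStateFunctional
      (diagonal fun i => ((![1, 0, 0] : Fin 3 → ℝ) i : ℂ)) = 0 := by
  have hA : (towerH L - (h : ℂ) • (towerO L + (towerO L)ᴴ)).IsHermitian := by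
    rw [sourced_eq]; exact diagonal_real_isHermitian _
  refine groundStateFunctional_eq_zero_of_mul_eq_smul hA (c := 0) ?_ ?_
  · rw [sourced_eq, diagonal_mul_diagonal, zero_smul]
    ext i j
    fin_cases i <;> fin_cases j <;> simp [sourcedDiag]
  · rw [groundEnergy_sourced hh hbig.le]
    have : (1 : ℝ) - h * (L : ℝ) ^ 2 ≠ 0 := by linarith
    exact_mod_cast (Ne.symm this)

/-- … hence `ω_h(H_L) = 1` there (`H_L = 1 − Π_B`). [folklore] -/
theorem sourced_functional_towerH {h : ℝ} {L : ℕ} (hh : 0 ≤ h) (hbig : 1 < h * (L : ℝ) ^ 2) :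
    (towerH L - (h : ℂ) • (towerO L + (towerO L)ᴴ)).groundStateFunctional (towerH L) = 1 := by
  have hA : (towerH L - (h : ℂ) • (towerO L + (towerO L)ᴴ)).IsHermitian := by
    rw [sourced_eq]; exact diagonal_real_isHermitian _
  have hsplit : towerH L = 1 - diagonal fun i => ((![1, 0, 0] : Fin 3 → ℝ) i : ℂ) := by
    ext i j
    fin_cases i <;> fin_cases j <;> simp [towerH, towerDiag]
  have e := congrArg (towerH L - (h : ℂ) • (towerO L + (towerO L)ᴴ)).groundStateFunctional hsplit
  rw [e, map_sub, groundStateFunctional_one hA, sourced_functional_darkProj hh hbig, sub_zero]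

/-- **The order in the sourced tracial ground state**: `Re ω_h(O_L)/L² = 1/2` as soon as `hL² > 1`
(`ω_h(O+Oᴴ) = (ω_h(H) − E₀)/h = L²`, and `Re ω(O) = Re ω(Oᴴ)`). [folklore] -/
theorem sourced_order_density {h : ℝ} {L : ℕ} (hh : 0 < h) (hbig : 1 < h * (L : ℝ) ^ 2) :
    ((towerH L - (h : ℂ) • (towerO L + (towerO L)ᴴ)).groundStateFunctional (towerO L)).re /
      (L : ℝ) ^ 2 = 1 / 2 := by
  set A := towerH L - (h : ℂ) • (towerO L + (towerO L)ᴴ) with hAdef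
  have hA : A.IsHermitian := by rw [hAdef, sourced_eq]; exact diagonal_real_isHermitian _
  have hL : (0 : ℝ) < (L : ℝ) ^ 2 := by nlinarith [hh.le, hbig, sq_nonneg (L : ℝ)]
  -- ω(A) = E₀ = 1 - hL², ω(H) = 1, and H = A + h (O + Oᴴ)
  have hE : A.groundStateFunctional A = ((1 - h * (L : ℝ) ^ 2 : ℝ) : ℂ) := by
    rw [groundStateFunctional_hamiltonian hA, hAdef, groundEnergy_sourced hh.le hbig.le]
  have hH : A.groundStateFunctional (towerH L) = 1 := by
    rw [hAdef]; exact sourced_functional_towerH hh.le hbig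
  have hdecomp : towerH L = A + (h : ℂ) • (towerO L + (towerO L)ᴴ) := by
    rw [hAdef, sub_add_cancel]
  have hS : A.groundStateFunctional (towerO L + (towerO L)ᴴ) = (((L : ℝ) ^ 2 : ℝ) : ℂ) := by
    have h1 := hH
    rw [hdecomp, map_add, map_smul, hE, smul_eq_mul] at h1
    have hh' : (h : ℂ) ≠ 0 := by exact_mod_cast hh.ne'
    apply mul_left_cancel₀ hh'
    push_cast at h1 ⊢
    linear_combination h1
  have hre : (A.groundStateFunctional (towerO L)).re = (L : ℝ) ^ 2 / 2 := by
    have h2 : (A.groundStateFunctional (towerO L + (towerO L)ᴴ)).re =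
        2 * (A.groundStateFunctional (towerO L)).re := by
      rw [map_add, Complex.add_re, groundStateFunctional_conjTranspose_re]; ring
    rw [hS, Complex.ofReal_re] at h2
    linarith
  rw [hre, div_right_comm, div_self hL.ne']

/-- For every fixed source `h > 0` the finite-volume order density is EXACTLY `1/2` from some volume on. [folklore] -/
theorem tower_density_eventually {h : ℝ} (hh : 0 < h) :
    ∀ᶠ L : ℕ in atTop, ((towerH (L + 1) - (h : ℂ) • (towerO (L + 1) + (towerO (L + 1))ᴴ)).groundStateFunctional
      (towerO (L + 1))).re / ((L + 1 : ℕ) : ℝ) ^ 2 = 1 / 2 := by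
  filter_upwards [eventually_gt_atTop (⌈1 / h⌉₊)] with L hL
  have hL' : 1 / h < (L : ℝ) := lt_of_le_of_lt (Nat.le_ceil _) (by exact_mod_cast hL)
  have hbig : 1 < h * (((L + 1 : ℕ) : ℝ) ^ 2) := by
    have h2 : 1 < h * (L : ℝ) := by
      rw [div_lt_iff₀ hh] at hL'; linarith
    have h3 : (L : ℝ) ≤ ((L + 1 : ℕ) : ℝ) ^ 2 := by
      have e : ((L + 1 : ℕ) : ℝ) = (L : ℝ) + 1 := by push_cast; ring
      rw [e]
      nlinarith [sq_nonneg (L : ℝ), (Nat.cast_nonneg L : (0 : ℝ) ≤ L)]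
    nlinarith
  exact sourced_order_density hh hbig

/-- **The tower family has Koma–Tasaki order parameter exactly `1/2`.** [folklore] -/
theorem ktOrderParameter_tower : ktOrderParameter towerH towerO = 1 / 2 := by
  unfold ktOrderParameter
  set F : ℝ → ℝ := fun h : ℝ => liminf (fun L : ℕ =>
      ((towerH (L + 1) - (h : ℂ) • (towerO (L + 1) + (towerO (L + 1))ᴴ)).groundStateFunctional
        (towerO (L + 1))).re / ((L + 1 : ℕ) : ℝ) ^ 2) atTop with hF
  have hinner : ∀ h : ℝ, 0 < h → F h = 1 / 2 := by
    intro h hh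
    simp only [hF]
    rw [liminf_congr (tower_density_eventually hh), liminf_const]
  have hev : ∀ᶠ h in 𝓝[>] (0 : ℝ), F h = (fun _ : ℝ => (1 / 2 : ℝ)) h :=
    eventually_nhdsWithin_of_forall (s := Set.Ioi (0 : ℝ)) fun h (hh : 0 < h) => hinner h hh
  rw [liminf_congr hev, liminf_const]

/-- **Source-free ground states: the UNIQUE ray `B`, dark, in the charge-`N` sector for every `N`.** [folklore] -/
theorem tower_groundStates (L : ℕ) (ψ : Fin 3 → ℂ) (hψ : (towerH L).IsGroundStateVector ψ) :
    ψ = ψ 0 • Pi.single 0 1 ∧ towerO L *ᵥ ψ = 0 ∧ ∀ N : ℕ, towerQ N *ᵥ ψ = (N : ℂ) • ψ := by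
  obtain ⟨-, hmem⟩ := (isGroundStateVector_iff _ _).1 hψ
  have hsupp : ∀ i, i ≠ (0 : Fin 3) → ψ i = 0 := by
    refine (mem_groundSpace_diagonal_iff towerDiag 0 (fun i hi => ?_) ψ).1 hmem
    fin_cases i
    · exact absurd rfl hi
    · simp [towerDiag]
    · simp [towerDiag]
  have h1 : ψ 1 = 0 := hsupp 1 (by decide)
  have h2 : ψ 2 = 0 := hsupp 2 (by decide)
  refine ⟨?_, ?_, fun N => ?_⟩
  · funext i
    fin_cases i <;> simp [h1, h2]
  · funext i
    fin_cases i <;> simp [towerO, towerM, mulVec, dotProduct, Fin.sum_univ_three, h1, h2]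
  · funext i
    fin_cases i <;>
      simp [towerQ, towerJ, mulVec, dotProduct, Fin.sum_univ_three, h1, h2, Matrix.one_apply]

/-- **Density matching is available at will**: the source-free tracial ground state gives the charge `Q_N` the value
`N`, for every `N` (selection rule: `H J = 1·J`, `E₀(H) = 0`). [folklore] -/
theorem tower_density (L N : ℕ) : (towerH L).groundStateFunctional (towerQ N) = N := by
  have hA := towerH_isHermitian L
  have hJ : (towerH L).groundStateFunctional towerJ = 0 := by
    refine groundStateFunctional_eq_zero_of_mul_eq_smul hA (c := 1) ?_ ?_
    · ext i j
      fin_cases i <;> fin_cases j <;>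
        simp [towerH, towerDiag, towerJ, Matrix.mul_apply, diagonal_apply]
    · rw [groundEnergy_towerH]; norm_num
  rw [towerQ, map_sub, map_smul, groundStateFunctional_one hA, hJ, sub_zero, smul_eq_mul, mul_one]

/-- **CERTIFICATE r1 (Negation lens, tower/number structure included): the crux SHAPE stays model-free false under
exact `U(1)` covariance.** There is a family `(H_L, O_L)` on `ℂ³` with a conserved charge `Q_N` (any sector label
`N`), `O_L` of charge `−2`, Koma–Tasaki order parameter `1/2` (literal `dWaveOrderParameter` shape), tracial density
`ω_{H_L}(Q_N) = N`, whose every source-free ground state is the unique ray `B`: in the charge-`N` sector, annihilated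
by `O_L`. Hence "KT order + number conservation + sector ground-state uniqueness + density matching ⇒ ground-state
(pair) order" is not a theorem of finite-dimensional spectral theory with the crux's order of limits. [folklore] -/
theorem u1Covariant_ssb_without_lro :
    ∃ (H O : ℕ → Matrix (Fin 3) (Fin 3) ℂ) (Q : ℕ → Matrix (Fin 3) (Fin 3) ℂ),
      (∀ L, (H L).IsHermitian) ∧ (∀ N, (Q N).IsHermitian) ∧
      (∀ L N, Q N * H L = H L * Q N) ∧
      (∀ L N, Q N * O L - O L * Q N = (-2 : ℂ) • O L) ∧
      ktOrderParameter H O = 1 / 2 ∧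
      (∀ L N, (H L).groundStateFunctional (Q N) = N) ∧
      (∀ L, (H L).groundEnergy = 0) ∧
      (∀ (L : ℕ) (ψ : Fin 3 → ℂ), (H L).IsGroundStateVector ψ →
        ψ = ψ 0 • Pi.single 0 1 ∧ O L *ᵥ ψ = 0 ∧ ∀ N : ℕ, Q N *ᵥ ψ = (N : ℂ) • ψ) :=
  ⟨towerH, towerO, towerQ, towerH_isHermitian, towerQ_isHermitian, fun L N => towerQ_mul_towerH N L,
    fun L N => towerQ_commutator_towerO N L, ktOrderParameter_tower, tower_density, groundEnergy_towerH,
    tower_groundStates⟩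

end Tower

/-! ## §3 The only honest cut is by parameter region — and it is not a decomposition of content -/

/-- The crux OFF the route's box: every `(U, δ, μ)` with `U > 0`, `δ ∈ (0,1)` NOT in `[2,3] × [1/5, 7/20]`. This is
the conjunct of `SsbToEvenTorusLro` that no deciding theorem of route AposterioriCapRg consumes (`closes_box'`).
[folklore] -/
def OffBoxTransfer : Prop :=
  ∀ U δ μ : ℝ, 0 < U → δ ∈ Ioo (0:ℝ) 1 → ¬ (U ∈ Icc (2:ℝ) 3 ∧ δ ∈ Icc (1/5:ℝ) (7/20)) → Body U δ μ

/-- Glue of the region split (trivial case analysis): `BoxTransfer → OffBoxTransfer → SsbToEvenTorusLro`.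
[folklore] -/
theorem crux_of_box_of_offBox (hB : BoxTransfer) (hO : OffBoxTransfer) : SsbToEvenTorusLro := by
  rw [crux_iff]
  intro U δ μ hU hδ
  by_cases hbox : U ∈ Icc (2:ℝ) 3 ∧ δ ∈ Icc (1/5:ℝ) (7/20)
  · exact hB U hbox.1 δ hbox.2 μ
  · exact hO U δ μ hU hδ hbox

theorem offBox_of_crux (h : SsbToEvenTorusLro) : OffBoxTransfer :=
  fun U δ μ hU hδ _ => (crux_iff.1 h) U δ μ hU hδ

/-- **The crux is exactly the box transfer AND the off-box transfer.** [folklore] -/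
theorem crux_iff_box_and_offBox : SsbToEvenTorusLro ↔ BoxTransfer ∧ OffBoxTransfer :=
  ⟨fun h => ⟨crux_imp_boxTransfer h, offBox_of_crux h⟩, fun h => crux_of_box_of_offBox h.1 h.2⟩

/-- The route's deciding theorem needs the BOX conjunct only (disprover's `closes_box`, re-exported): the off-box
conjunct is outside the cone of `closes`. [folklore] -/
theorem closes_box' (hS : BoxTransfer) (hT : FixedPointDWaveOrder) : _root_.HubbardSuperconductivity :=
  closes_box hS hT

/-- **What the off-box conjunct asserts on its own** (summit-independent global content): at EVERY coupling `U > 3`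
and every `δ ∈ (0,1)`, if the summit's `(N_L, S^z = 0)` sector is eventually Nagaoka-saturated then NO chemical
potential density-matched to `1 − δ` carries Koma–Tasaki `d`-wave order — a classification statement about the
strong-coupling `T = 0` phase diagram (first-order FM/`d`-SC boundaries in `μ` are forbidden to select the
ferromagnet), for which no technique exists at any `U` (Tasaki1998 §4.4) and which the summit does not need.
[cite: Tasaki1998, §4.4] -/
theorem offBox_imp_noOrder_of_eventually_saturated (hO : OffBoxTransfer) {U δ : ℝ} (hU : 3 < U)
    (hδ : δ ∈ Ioo (0:ℝ) 1) (hFM : ∀ᶠ L : ℕ in atTop, SaturatedAt U δ L) {μ : ℝ}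
    (hd : DensityMatched U δ μ) : ¬ HasDWaveOrder U μ := by
  intro ho
  have hbox : ¬ (U ∈ Icc (2:ℝ) 3 ∧ δ ∈ Icc (1/5:ℝ) (7/20)) := fun h => by linarith [h.1.2]
  have hmat : HasDWavePairFieldLROAt U δ := hO U δ μ (by linarith) hδ hbox hd ho
  exact not_matrix_of_eventually_saturated (by linarith [hδ.1]) hFM hmat

end Summit.HubbardSuperconductivity.HubbardSuperconductivity.Cruxes.SsbToEvenTorusLro.StrategyCensusR1

end
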